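import Literature.Computability.MetaComplexity.OneSidedHeuristicsProofs
import Literature.Computability.MetaComplexity.SearchHeuristicSchemesPCP
import HarnessLib

/-!
# Discharges of named facts of `UniversalHeuristicSchemes.lean`

`Literature/Computability/MetaComplexity/UniversalHeuristicSchemesHolds.lean` — proofs-only
sibling of `UniversalHeuristicSchemes.lean` (no definitions, no named facts). Each theorem
below closes a named fact `X : Prop` of that file as `X_holds : X` by composing an ACCEPTED
reduction theorem of the tree with the ACCEPTED unconditional `_holds` discharges of all of
its hypotheses; nothing is re-proved and no statement is changed. Recorded by the librarian
sweep g25 (2026-08-16, pass 5c: facts dischargeable in one line from the tree's own lemmas),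
so that the facts census, `#h21_route_deps` and the cone guardrail see these facts as
theorems.

Discharged here:

* `Hirahara2021_hasUHS_of_mem_UP_holds` := `Hirahara2021_hasUHS_of_mem_UP_of_search`
  `Hirahara2021_UP_searchUHS_of_Avg1P_holds` (`OneSidedHeuristicsProofs.lean`).

## References

* [Hirahara2021] — see `lean/references.bib` and the docstring of the fact in `UniversalHeuristicSchemes.lean`.
-/

namespace Literature.Computability.MetaComplexity

/-- **Discharge of the named fact `Hirahara2021_hasUHS_of_mem_UP`**
(`UniversalHeuristicSchemes.lean`): Hirahara 2021, Lemma 2.2 (1). *If `DistNP ⊆ AvgP`, then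
every language in `UP` admits a universal heuristic scheme.* (Proved in the paper via §11:
`DistNP ⊆ AvgP` gives `coNP × {U, T} ⊆ Avg¹_{1-n^{-c}} P`; `UP ⊆ NP_sv` (Fact 8.4); Cor. … —
obtained as `Hirahara2021_hasUHS_of_mem_UP_of_search` applied to the tree's unconditional
discharge `Hirahara2021_UP_searchUHS_of_Avg1P_holds` of its hypothesis (reduction in
`OneSidedHeuristicsProofs.lean`).
[cite: Hirahara2021, Lemma 2.2 (1)] -/
theorem Hirahara2021_hasUHS_of_mem_UP_holds :
    Hirahara2021_hasUHS_of_mem_UP :=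
  Hirahara2021_hasUHS_of_mem_UP_of_search Hirahara2021_UP_searchUHS_of_Avg1P_holds

end Literature.Computability.MetaComplexity
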